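import Summits.Langlands.Langlands.Theorems.RamifiedCoefficientSeedAdjointLiftingGL3BirthDefs4
import Literature.NumberTheory.GaloisRepresentations.SerreWeightShapeProofs
import Literature.NumberTheory.GaloisRepresentations.TameInertiaProofs
import Literature.NumberTheory.GaloisRepresentations.RamificationFiltrationProofs
import Literature.NumberTheory.GaloisRepresentations.GlobalArtinMapOfCharactersProofs
import Literature.NumberTheory.GaloisRepresentations.CalegariEvenFontaineMazurTwo
import HarnessLib

/-!
# Crux `AdjointLiftingGL3` (stmt-Langlands-16779), line `birth`: linear algebra for CORE-B
# `stub_localShapeWild` (the wild case of the local Fontaine–Laffaille stub S2a)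

Elementary `2 × 2` / `3 × 3` matrix lemmas used by the proof of `stub_localShapeWild` (file
`…StubLocalShapeWild.lean`): the inverse and the framed adjoint `Ad⁰` (accepted `glAdZeroTwoFrame`,
`coe_glAdZeroTwoFrame_apply`) of an upper triangular `U ∈ GL₂`, conjugation by the transposition
matrix of the first two basis vectors of `k³`, the middle block of a `3 × 3` matrix, and: a
diagonalisable unipotent `(1 y; 0 1)` is trivial.  The mathematical context (why these are needed) is
recalled below; theorems only, no `sorry`, no definition, no named fact.

Setting (`…BirthDefs4`): `K` a non-archimedean local field with `#𝓀[K] = p ≥ 11`,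
`k = ℤ̄_p/𝔪 = padicAlgClResidueField p`, `V : Γ_K → GL₂(k)` and `χ : Γ_K → GL₁(k)` with open kernels,
`T = P₀ (χ · Ad⁰ V) P₀⁻¹` (`IsTwistedAdZero`), Fontaine–Laffaille data `FLDataAt K p T ι ϖ hϖ {0,1,2}`,
`χ|_I = ω⁻¹` (`InertialCharEq`) and a wild frame `P` of `V` (`WildFrameOf`: `V` not tame, `P V P⁻¹`
upper triangular on `Γ_K` with inertial diagonal `(ω^{s+e}, ω^s)`, `e = ±1`).  Conclusion:
`LocalShapeT K p V ι ϖ hϖ` (level one: `P V(σ) P⁻¹ = ω(σ)^s (ω(σ) c; 0 1)` on `I_K` and `V = 1` on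
every `I_K^u`, `u > 1`).

Proof.  Write `U = P V P⁻¹ = (a c; 0 b)`.  In the basis `(E, H, F)` of `ad⁰` the matrix of
`Ad⁰(U)` is upper triangular with diagonal `(a/b, 1, b/a)` and `(E,H)`-entry `-2c/b`
(`adZero_entries_of_upperTriangular`, from the accepted `coe_glAdZeroTwoFrame_apply`), so in the
frame `R = Π · Ad⁰(P) · P₀⁻¹` (`Π` the transposition of the first two basis vectors) the reduction
`T` is upper triangular on `Γ_K` with middle `2 × 2` block `χ · (a/b, -2c/b; 0, 1)`
(`frame_entries`).  On `I_K^u`, `u > 0`, the diagonal characters `a, b, χ` are trivial (their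
values have `p`-power order: `absUpperInertia_map_isPGroup_holds`), so the middle block is the
unipotent `(1, -2c(σ); 0, 1)`; a simultaneous diagonalisation of the middle block over `Γ_K` would
make these trivial, i.e. `c = 0` and `V = 1` on every `I_K^u`, `u > 0` — `V` tame, excluded: the
block is NON-SPLIT.  Its inertial diagonal is `(ω^{-1} ω^{e}, ω^{-1}) = (ω^{-b}, ω^{-a})` with
`a = 1`, `b = 1 - e ∈ {0, 2} ⊂ {0,1,2}`, so conjunct (ii) of (F13) gives `b < a` — excluding
`e = -1` — and, for `e = 1` (`a = b + 1`), that the block is trivial on every `I_K^v`, `v > 1`,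
whence `c = 0` and `V = 1` there (`p ≠ 2`); with `U = ω^s (ω, c/ω^s; 0, 1)` on `I_K` this is
`LocalShapeT`.  No `sorry`, no new definition, no named fact.

References: Gee–Herzig–Liu–Savitt, Doc. Math. 22 (2017), Prop. 2.3.1 (Fontaine–Laffaille lifts are
peu ramifiés) and Examples 2.1.4 (1); Clozel–Harris–Taylor, Publ. IHÉS 108, Lemma 2.4.2 (ordering of
the weights of a non-split extension); Serre, Duke Math. J. 54 (1987), §2.4 (the wild case).
-/

set_option linter.dupNamespace false -- `Summit.Langlands.Langlands` is the mandated namespace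

noncomputable section

namespace Summit.Langlands.Langlands.Cruxes.AdjointLiftingGL3.Birth

open scoped MatrixGroups NumberField Valued
open NumberField IsDedekindDomain Field Filter ValuativeRel
open Literature.NumberTheory.GaloisRepresentations Literature.NumberTheory.PAdicHodge
open Literature.NumberTheory.GaloisRepresentations.IsNonarchimedeanLocalField

section LinearAlgebra

variable {k : Type*} [Field k]

/-- The inverse of an upper triangular `U = (a c; 0 b) ∈ GL₂` is `(a⁻¹, -c a⁻¹ b⁻¹; 0, b⁻¹)`.
[folklore] -/
theorem inv_entries_of_upperTriangular (U : GL (Fin 2) k)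
    (hU : (U : Matrix (Fin 2) (Fin 2) k) 1 0 = 0) :
    (U : Matrix (Fin 2) (Fin 2) k) 0 0 ≠ 0 ∧ (U : Matrix (Fin 2) (Fin 2) k) 1 1 ≠ 0 ∧
    ((U⁻¹ : GL (Fin 2) k) : Matrix (Fin 2) (Fin 2) k) 1 0 = 0 ∧
    ((U⁻¹ : GL (Fin 2) k) : Matrix (Fin 2) (Fin 2) k) 0 0 = ((U : Matrix (Fin 2) (Fin 2) k) 0 0)⁻¹ ∧
    ((U⁻¹ : GL (Fin 2) k) : Matrix (Fin 2) (Fin 2) k) 1 1 = ((U : Matrix (Fin 2) (Fin 2) k) 1 1)⁻¹ ∧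
    ((U⁻¹ : GL (Fin 2) k) : Matrix (Fin 2) (Fin 2) k) 0 1 =
      -((U : Matrix (Fin 2) (Fin 2) k) 0 1) * ((U : Matrix (Fin 2) (Fin 2) k) 0 0)⁻¹ *
        ((U : Matrix (Fin 2) (Fin 2) k) 1 1)⁻¹ := by
  set W := ((U⁻¹ : GL (Fin 2) k) : Matrix (Fin 2) (Fin 2) k) with hW
  have hmul : (U : Matrix (Fin 2) (Fin 2) k) * W = 1 := by
    rw [hW, ← Matrix.GeneralLinearGroup.coe_mul, mul_inv_cancel, Matrix.GeneralLinearGroup.coe_one]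
  have hdet : (U : Matrix (Fin 2) (Fin 2) k).det ≠ 0 :=
    (Matrix.isUnit_iff_isUnit_det _ |>.mp (Units.isUnit U)).ne_zero
  rw [Matrix.det_fin_two, hU, mul_zero, sub_zero] at hdet
  have ha : (U : Matrix (Fin 2) (Fin 2) k) 0 0 ≠ 0 := left_ne_zero_of_mul hdet
  have hb : (U : Matrix (Fin 2) (Fin 2) k) 1 1 ≠ 0 := right_ne_zero_of_mul hdet
  have e10 := congrFun (congrFun hmul 1) 0
  have e11 := congrFun (congrFun hmul 1) 1
  have e00 := congrFun (congrFun hmul 0) 0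
  have e01 := congrFun (congrFun hmul 0) 1
  simp only [Matrix.mul_apply, Fin.sum_univ_two, Matrix.one_apply_eq,
    Matrix.one_apply_ne (by decide : (1 : Fin 2) ≠ 0), Matrix.one_apply_ne (by decide : (0 : Fin 2) ≠ 1),
    hU, zero_mul, zero_add] at e10 e11 e00 e01
  have hW10 : W 1 0 = 0 := (mul_eq_zero.mp e10).resolve_left hb
  have hW11 : W 1 1 = ((U : Matrix (Fin 2) (Fin 2) k) 1 1)⁻¹ :=
    (inv_eq_of_mul_eq_one_right e11).symm
  rw [hW10, mul_zero, add_zero] at e00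
  have hW00 : W 0 0 = ((U : Matrix (Fin 2) (Fin 2) k) 0 0)⁻¹ :=
    (inv_eq_of_mul_eq_one_right e00).symm
  have hW01 : W 0 1 = -((U : Matrix (Fin 2) (Fin 2) k) 0 1) * ((U : Matrix (Fin 2) (Fin 2) k) 0 0)⁻¹ *
      ((U : Matrix (Fin 2) (Fin 2) k) 1 1)⁻¹ := by
    rw [hW11] at e01
    have h1 : W 0 1 = (-(((U : Matrix (Fin 2) (Fin 2) k) 0 1) * ((U : Matrix (Fin 2) (Fin 2) k) 1 1)⁻¹)) *
        ((U : Matrix (Fin 2) (Fin 2) k) 0 0)⁻¹ := by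
      rw [eq_mul_inv_iff_mul_eq₀ ha]
      linear_combination e01
    rw [h1]; ring
  exact ⟨ha, hb, hW10, hW00, hW11, hW01⟩

/-- **`Ad⁰` of an upper triangular matrix.**  For `U = (a c; 0 b) ∈ GL₂(k)` the matrix of
`Ad⁰(U)` in the basis `(H, E, F)` (accepted `glAdZeroTwoFrame`, `coe_glAdZeroTwoFrame_apply`) has
entries `(H,H) = 1`, `(H,E) = 0`, `(E,H) = -2c/b`, `(E,E) = a/b`, `(F,H) = (F,E) = 0`. [folklore] -/
theorem adZero_entries_of_upperTriangular :
    ∀ (U : GL (Fin 2) k), (U : Matrix (Fin 2) (Fin 2) k) 1 0 = 0 →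
    ((glAdZeroTwoFrame k U : GL (Fin 3) k) : Matrix (Fin 3) (Fin 3) k) 0 0 = 1 ∧
    ((glAdZeroTwoFrame k U : GL (Fin 3) k) : Matrix (Fin 3) (Fin 3) k) 0 1 = 0 ∧
    ((glAdZeroTwoFrame k U : GL (Fin 3) k) : Matrix (Fin 3) (Fin 3) k) 1 0 =
      -2 * (U : Matrix (Fin 2) (Fin 2) k) 0 1 * ((U : Matrix (Fin 2) (Fin 2) k) 1 1)⁻¹ ∧
    ((glAdZeroTwoFrame k U : GL (Fin 3) k) : Matrix (Fin 3) (Fin 3) k) 1 1 =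
      (U : Matrix (Fin 2) (Fin 2) k) 0 0 * ((U : Matrix (Fin 2) (Fin 2) k) 1 1)⁻¹ ∧
    ((glAdZeroTwoFrame k U : GL (Fin 3) k) : Matrix (Fin 3) (Fin 3) k) 2 0 = 0 ∧
    ((glAdZeroTwoFrame k U : GL (Fin 3) k) : Matrix (Fin 3) (Fin 3) k) 2 1 = 0 := by
  intro U hU
  obtain ⟨ha, hb, hW10, hW00, hW11, hW01⟩ := inv_entries_of_upperTriangular U hU
  set Um := (U : Matrix (Fin 2) (Fin 2) k) with hUm
  set W := ((U⁻¹ : GL (Fin 2) k) : Matrix (Fin 2) (Fin 2) k) with hW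
  rw [coe_glAdZeroTwoFrame_apply]
  have h00 : adZeroTwoMatrixOf k Um W 0 0 = Um 0 0 * W 0 0 - Um 0 1 * W 1 0 := rfl
  have h01 : adZeroTwoMatrixOf k Um W 0 1 = Um 0 0 * W 1 0 := rfl
  have h10 : adZeroTwoMatrixOf k Um W 1 0 = Um 0 0 * W 0 1 - Um 0 1 * W 1 1 := rfl
  have h11 : adZeroTwoMatrixOf k Um W 1 1 = Um 0 0 * W 1 1 := rfl
  have h20 : adZeroTwoMatrixOf k Um W 2 0 = Um 1 0 * W 0 0 - Um 1 1 * W 1 0 := rfl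
  have h21 : adZeroTwoMatrixOf k Um W 2 1 = Um 1 0 * W 1 0 := rfl
  rw [h00, h01, h10, h11, h20, h21, hW10, hW00, hW11, hW01, hU]
  refine ⟨?_, ?_, ?_, rfl, ?_, ?_⟩
  · rw [mul_inv_cancel₀ ha, mul_zero, sub_zero]
  · rw [mul_zero]
  · field_simp
    ring
  · rw [zero_mul, mul_zero, sub_zero]
  · rw [zero_mul]

/-- Conjugating a `3 × 3` matrix by the transposition matrix of the first two basis vectors permutes
rows and columns accordingly. [folklore] -/
theorem swap_conj_apply (N : Matrix (Fin 3) (Fin 3) k) (r c : Fin 3) :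
    ((!![0, 1, 0; 1, 0, 0; 0, 0, 1] : Matrix (Fin 3) (Fin 3) k) * N *
        (!![0, 1, 0; 1, 0, 0; 0, 0, 1] : Matrix (Fin 3) (Fin 3) k)) r c =
      N (Equiv.swap (0 : Fin 3) 1 r) (Equiv.swap (0 : Fin 3) 1 c) := by
  fin_cases r <;> fin_cases c <;> simp only [Matrix.mul_apply, Fin.sum_univ_three] <;>
    simp [Equiv.swap_apply_of_ne_of_ne]

/-- The transposition matrix is an involution. [folklore] -/
theorem swap_mul_swap :
    ((!![0, 1, 0; 1, 0, 0; 0, 0, 1] : Matrix (Fin 3) (Fin 3) k) *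
        (!![0, 1, 0; 1, 0, 0; 0, 0, 1] : Matrix (Fin 3) (Fin 3) k)) = 1 := by
  ext i j
  fin_cases i <;> fin_cases j <;> simp [Matrix.mul_apply, Fin.sum_univ_three]

/-- A `2 × 2` unipotent `(1 y; 0 1)` which is diagonalisable is trivial: `y = 0`. [folklore] -/
theorem eq_zero_of_unipotent_conj_diagonal (Q : GL (Fin 2) k) (y : k)
    (h01 : ((Q : Matrix (Fin 2) (Fin 2) k) * !![1, y; 0, 1] * ((Q⁻¹ : GL (Fin 2) k) : Matrix (Fin 2) (Fin 2) k)) 0 1 = 0)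
    (h10 : ((Q : Matrix (Fin 2) (Fin 2) k) * !![1, y; 0, 1] * ((Q⁻¹ : GL (Fin 2) k) : Matrix (Fin 2) (Fin 2) k)) 1 0 = 0) :
    y = 0 := by
  set Qm := (Q : Matrix (Fin 2) (Fin 2) k) with hQm
  set Qi := ((Q⁻¹ : GL (Fin 2) k) : Matrix (Fin 2) (Fin 2) k) with hQi
  have hQQ : Qm * Qi = 1 := by
    rw [hQm, hQi, ← Matrix.GeneralLinearGroup.coe_mul, mul_inv_cancel, Matrix.GeneralLinearGroup.coe_one]
  have hQQ' : Qi * Qm = 1 := by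
    rw [hQm, hQi, ← Matrix.GeneralLinearGroup.coe_mul, inv_mul_cancel, Matrix.GeneralLinearGroup.coe_one]
  -- `D = Q (mid) Q⁻¹`, `E = D - 1 = Q Nil Q⁻¹` with `Nil = (0 y; 0 0)`, `Nil² = 0`
  set Nil : Matrix (Fin 2) (Fin 2) k := !![0, y; 0, 0] with hNil
  have hmid : (!![1, y; 0, 1] : Matrix (Fin 2) (Fin 2) k) = 1 + Nil := by
    rw [hNil]; ext i j; fin_cases i <;> fin_cases j <;> simp
  set E : Matrix (Fin 2) (Fin 2) k := Qm * Nil * Qi with hE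
  have hE' : Qm * !![1, y; 0, 1] * Qi = 1 + E := by
    rw [hmid, Matrix.mul_add, Matrix.add_mul, Matrix.mul_one, hQQ, hE]
  rw [hE'] at h01 h10
  simp only [Matrix.add_apply, Matrix.one_apply_ne (by decide : (0 : Fin 2) ≠ 1),
    Matrix.one_apply_ne (by decide : (1 : Fin 2) ≠ 0), zero_add] at h01 h10
  have hNil2 : Nil * Nil = 0 := by
    rw [hNil]; ext i j; fin_cases i <;> fin_cases j <;> simp [Matrix.mul_apply, Fin.sum_univ_two]
  have hE2 : E * E = 0 := by
    rw [hE]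
    calc Qm * Nil * Qi * (Qm * Nil * Qi) = Qm * Nil * (Qi * Qm) * Nil * Qi := by
          simp only [Matrix.mul_assoc]
      _ = 0 := by rw [hQQ', Matrix.mul_one, Matrix.mul_assoc Qm Nil Nil, hNil2, Matrix.mul_zero,
          Matrix.zero_mul]
  -- `E` is diagonal with `E² = 0`, hence `E = 0`
  have hE00 : E 0 0 = 0 := by
    have := congrFun (congrFun hE2 0) 0
    simp only [Matrix.mul_apply, Fin.sum_univ_two, h01, zero_mul, add_zero, Matrix.zero_apply] at this
    exact pow_eq_zero_iff two_ne_zero |>.mp (by rw [pow_two]; exact this)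
  have hE11 : E 1 1 = 0 := by
    have := congrFun (congrFun hE2 1) 1
    simp only [Matrix.mul_apply, Fin.sum_univ_two, h10, zero_mul, zero_add, Matrix.zero_apply] at this
    exact pow_eq_zero_iff two_ne_zero |>.mp (by rw [pow_two]; exact this)
  have hE0 : E = 0 := by
    ext i j; fin_cases i <;> fin_cases j
    · exact hE00
    · exact h01
    · exact h10
    · exact hE11
  -- `Nil = Q⁻¹ E Q = 0`
  have hNil0 : Nil = 0 := by
    have : Qi * E * Qm = Nil := by
      rw [hE]
      calc Qi * (Qm * Nil * Qi) * Qm = (Qi * Qm) * Nil * (Qi * Qm) := by simp only [Matrix.mul_assoc]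
        _ = Nil := by rw [hQQ', Matrix.one_mul, Matrix.mul_one]
    rw [← this, hE0, Matrix.mul_zero, Matrix.zero_mul]
  have := congrFun (congrFun hNil0 0) 1
  simpa [hNil] using this

omit [Field k] in
/-- The middle `2 × 2` block at index `0` of a `3 × 3` matrix. [folklore] -/
theorem middleBlock_zero_three (N : Matrix (Fin 3) (Fin 3) k) (hi : 0 + 1 < 3) :
    middleBlock N 0 hi = !![N 0 0, N 0 1; N 1 0, N 1 1] := by
  ext r c
  fin_cases r <;> fin_cases c <;> rfl

end LinearAlgebra

end Summit.Langlands.Langlands.Cruxes.AdjointLiftingGL3.Birth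

end
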